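import Mathlib.NumberTheory.PrimesCongruentOne
import Mathlib.Data.Nat.Log
import Literature.Computability.Complexity.AutomaticSequencesBlocks
import HarnessLib

/-!
# Liouville's `λ` is not `k`-automatic (Coons 2010, Theorem 1.5) — proof

Discharge of the named fact `Literature.Computability.Complexity.coons_liouville_not_automatic`
of `AutomaticSequences.lean`:
`theorem coons_liouville_not_automatic_holds : coons_liouville_not_automatic`.

## Source and proof

M. Coons, *(Non)Automaticity of number theoretic functions*, J. Théor. Nombres Bordeaux **22**
(2010) 339–352 [Coons2011], Theorem 1.5 and Corollary 1.7 (read in the arXiv text 0810.3709,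
statements p. 2, proof p. 6). The PRINTED proof is analytic (`Σ λ(n) n^{-s} = ζ(2s)/ζ(s)` has
`≍ T log T` poles up to height `T` by von Mangoldt/Selberg/PNT, versus `O(T)` for the Dirichlet
series of an automatic sequence, Allouche–Mendès France–Peyrière) and is out of reach of Mathlib.
We give instead an ELEMENTARY proof through the following special case of J.-C. Schlage-Puchta,
*Completely multiplicative automatic functions*, Integers **11** (2011) A31 [Schlagepuchta2011],
Proposition 1 ("there exists `k` such that `f n₁ = f n₂` whenever `n₁ ≡ n₂ (mod q^{k+ℓ})`,
`(n₁, q^{ℓ+1}) ∣ q^ℓ`", for non-vanishing completely multiplicative `q`-automatic `f`):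

* `exists_pow_forall_mod_eq_one`: a completely multiplicative `f : ℕ → ℤ`, `±1`-valued on
  positive integers, with finite `k`-kernel (`k ≥ 2`) satisfies `f ≡ 1` on `{y : y ≡ 1 (mod k^l)}`
  for some `l ≥ 1`.

Schlage-Puchta's proof combines van der Waerden's theorem (combinatorial; formalized in
`AutomaticSequencesBlocks.lean` as `exists_blocks_const`: `f ≡ ε` on the blocks
`Z_t = {n ∈ [u Y_t, (u+1) Y_t) : n ≡ w (mod Q)}`, `Q = k^l`, `Y_t = k^{l+J+tπ}`, all `t`) with
the Wirsing–Halász mean-value theorem (analytic, not available). The analytic half is replaced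
here by two elementary steps (this replacement is ours; it is not in the sources):

* `eq_one_of_blocks_window` (**window lemma**): every `m ≡ 1 (mod Q)` with
  `ρ^d / c ≤ m ≤ c ρ^d` for some `d`, where `ρ = k^π`, `c = 1 + 1/(4u)`, has `f m = 1` — pick
  `n ∈ Z_2` with `m n ∈ Z_{2+d}` (room `≥ Y_2 / 2 ≥ Q`), so `ε = f (m n) = f m · ε`.
* endgame in `exists_pow_forall_mod_eq_one`: if `f y = -1`, `y ≡ 1 (mod Q)`, let
  `z = (k^s + 1)^2` (`Q ∣ k^s`, `k^s ≥ 12u + 2`, `2s = πE`): `z ≡ 1`, `f z = 1`,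
  `ρ^E < z ≤ c ρ^E`; the first `i` with `c · y z^i > ρ^{a+Ei+1}` (`ρ^a ≤ y < ρ^{a+1}`) puts
  `m = y z^i` in a window, so `f m = 1`, while `f m = f y (f z)^i = -1`.

Finally `λ` (`ArithmeticFunction.liouville`, completely multiplicative, `λ n = (-1)^{Ω n}` for
`n ≠ 0`) would be `1` at every prime `p ≡ 1 (mod k^l)` (Mathlib `Nat.exists_prime_gt_modEq_one`),
but `λ p = -1`. No definitions and no named facts are introduced. (Corollary 1.7,
`coons_cardFactors_mod_two_not_automatic_holds`, is proved independently in
`AutomaticSequencesCoonsProofs.lean`; a parallel vendoring of Theorem 1.5 under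
`Literature.NumberTheory.LFunctions` has its own proof in
`NumberTheory/LFunctions/LiouvilleNotAutomaticProofs.lean` with a different, `λ`-specific ending,
whereas `exists_pow_forall_mod_eq_one` below applies to every `±1`-valued completely
multiplicative `f`. The module docstring of `AutomaticSequencesBlocks.lean` calls the present file
`AutomaticSequencesProofs.lean`; that name was taken meanwhile by the Allouche–Shallit proof.)
-/

namespace Literature.Computability.Complexity

section CompletelyMultiplicative

variable {k : ℕ} {f : ℕ → ℤ}

/-- Arithmetic core of the window lemma, case `m ≥ P`: with `n := u Y + w` (`w < Q`,
`4Q ≤ Y`, `4u m ≤ (4u+1) P`) one has `u (Y P) ≤ m n < (u + 1) (Y P)`. [folklore] -/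
theorem window_arith_ge {u w Q Y P m : ℕ} (hu : 1 ≤ u) (hwQ : w < Q) (h4Q : 4 * Q ≤ Y)
    (hhi : 4 * u * m ≤ (4 * u + 1) * P) (hdm : P ≤ m) (hP : 0 < P) :
    u * (Y * P) ≤ m * (u * Y + w) ∧ m * (u * Y + w) < (u + 1) * (Y * P) := by
  constructor
  · calc u * (Y * P) = P * (u * Y) := by ring
      _ ≤ m * (u * Y) := Nat.mul_le_mul_right _ hdm
      _ ≤ m * (u * Y + w) := Nat.mul_le_mul_left _ (Nat.le_add_right _ _)
  · have h1 : (4 * u + 1) * w < (4 * u + 1) * Q := Nat.mul_lt_mul_of_pos_left hwQ (by omega)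
    have h2 : (4 * u + 1) * Q ≤ 12 * u * Q := Nat.mul_le_mul_right Q (by omega)
    have h3 : 12 * u * Q ≤ 3 * u * Y :=
      calc 12 * u * Q = 3 * u * (4 * Q) := by ring
        _ ≤ 3 * u * Y := Nat.mul_le_mul_left _ h4Q
    have key : (4 * u + 1) * (u * Y + w) < 4 * u * ((u + 1) * Y) :=
      calc (4 * u + 1) * (u * Y + w) = (4 * u + 1) * w + (4 * u + 1) * (u * Y) := by ring
        _ < (4 * u + 1) * Q + (4 * u + 1) * (u * Y) := Nat.add_lt_add_right h1 _
        _ ≤ 12 * u * Q + (4 * u + 1) * (u * Y) := Nat.add_le_add_right h2 _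
        _ ≤ 3 * u * Y + (4 * u + 1) * (u * Y) := Nat.add_le_add_right h3 _
        _ = 4 * u * ((u + 1) * Y) := by ring
    have : 4 * u * (m * (u * Y + w)) < 4 * u * ((u + 1) * (Y * P)) :=
      calc 4 * u * (m * (u * Y + w)) = (4 * u * m) * (u * Y + w) := by ring
        _ ≤ ((4 * u + 1) * P) * (u * Y + w) := Nat.mul_le_mul_right _ hhi
        _ = P * ((4 * u + 1) * (u * Y + w)) := by ring
        _ < P * (4 * u * ((u + 1) * Y)) := Nat.mul_lt_mul_of_pos_left key hP
        _ = 4 * u * ((u + 1) * (Y * P)) := by ring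
    exact Nat.lt_of_mul_lt_mul_left this

/-- Arithmetic core of the window lemma, case `m < P`: with `Y = Q (c' + 1)` (`c' ≥ 1`) and
`n := u Y + Q c' + w = (u+1) Y - Q + w` one has `n ∈ [u Y, (u+1) Y)` and
`u (Y P) ≤ m n < (u + 1) (Y P)`. [folklore] -/
theorem window_arith_lt {u w Q c' P m : ℕ} (hu : 1 ≤ u) (hwQ : w < Q) (hc' : 1 ≤ c')
    (hlo : 4 * u * P ≤ (4 * u + 1) * m) (hdm : m < P) :
    u * (Q * (c' + 1)) ≤ u * (Q * (c' + 1)) + Q * c' + w ∧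
    u * (Q * (c' + 1)) + Q * c' + w < (u + 1) * (Q * (c' + 1)) ∧
    u * (Q * (c' + 1) * P) ≤ m * (u * (Q * (c' + 1)) + Q * c' + w) ∧
    m * (u * (Q * (c' + 1)) + Q * c' + w) < (u + 1) * (Q * (c' + 1) * P) := by
  have hP : 0 < P := lt_of_le_of_lt (Nat.zero_le _) hdm
  have hnlt : u * (Q * (c' + 1)) + Q * c' + w < (u + 1) * (Q * (c' + 1)) :=
    calc u * (Q * (c' + 1)) + Q * c' + w < u * (Q * (c' + 1)) + Q * c' + Q :=
          Nat.add_lt_add_left hwQ _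
      _ = (u + 1) * (Q * (c' + 1)) := by ring
  have hnpos : 0 < u * (Q * (c' + 1)) + Q * c' + w := by
    have : 0 < Q := lt_of_le_of_lt (Nat.zero_le _) hwQ
    have : 0 < Q * c' := Nat.mul_pos this hc'
    omega
  refine ⟨Nat.le_add_right_of_le (Nat.le_add_right _ _), hnlt, ?_, ?_⟩
  · have hQc : Q ≤ 3 * (Q * c') :=
      calc Q = Q * 1 := (mul_one Q).symm
        _ ≤ Q * c' := Nat.mul_le_mul_left Q hc'
        _ ≤ 3 * (Q * c') := Nat.le_mul_of_pos_left _ (by norm_num)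
    have h4n : (4 * u + 1) * (Q * (c' + 1)) ≤ 4 * (u * (Q * (c' + 1)) + Q * c' + w) :=
      calc (4 * u + 1) * (Q * (c' + 1)) = 4 * (u * (Q * (c' + 1))) + Q * c' + Q := by ring
        _ ≤ 4 * (u * (Q * (c' + 1))) + Q * c' + 3 * (Q * c') := Nat.add_le_add_left hQc _
        _ = 4 * (u * (Q * (c' + 1)) + Q * c') := by ring
        _ ≤ 4 * (u * (Q * (c' + 1)) + Q * c' + w) := Nat.mul_le_mul_left 4 (Nat.le_add_right _ _)
    have : (4 * u + 1) * (u * (Q * (c' + 1) * P)) ≤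
        (4 * u + 1) * (m * (u * (Q * (c' + 1)) + Q * c' + w)) :=
      calc (4 * u + 1) * (u * (Q * (c' + 1) * P))
            = u * P * ((4 * u + 1) * (Q * (c' + 1))) := by ring
        _ ≤ u * P * (4 * (u * (Q * (c' + 1)) + Q * c' + w)) := Nat.mul_le_mul_left _ h4n
        _ = (4 * u * P) * (u * (Q * (c' + 1)) + Q * c' + w) := by ring
        _ ≤ ((4 * u + 1) * m) * (u * (Q * (c' + 1)) + Q * c' + w) := Nat.mul_le_mul_right _ hlo
        _ = (4 * u + 1) * (m * (u * (Q * (c' + 1)) + Q * c' + w)) := by ring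
    exact Nat.le_of_mul_le_mul_left this (by omega)
  · calc m * (u * (Q * (c' + 1)) + Q * c' + w) < P * (u * (Q * (c' + 1)) + Q * c' + w) :=
          Nat.mul_lt_mul_of_pos_right hdm hnpos
      _ < P * ((u + 1) * (Q * (c' + 1))) := Nat.mul_lt_mul_of_pos_left hnlt hP
      _ = (u + 1) * (Q * (c' + 1) * P) := by ring

/-- **Window lemma (our elementary replacement for the mean-value step in Schlage-Puchta's
proof).** In the situation of `exists_blocks_const` (`f` completely multiplicative, `±1`-valued
on positive integers, `f ≡ ε` on the blocks `Z_t = {n ∈ [u Y_t, (u+1) Y_t) : n ≡ w (mod Q)}`,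
`Q = k^l`, `Y_t = k^{l+J+tπ}`, `π ≥ 1`, `u ≥ 1`), every `m ≡ 1 (mod Q)` lying within the factor
`1 + 1/(4u)` of a power `ρ^d`, `ρ = k^π` — precisely `4u ρ^d ≤ (4u+1) m` and `4u m ≤ (4u+1) ρ^d` —
has `f m = 1`: there is `n ∈ Z_2` (`n = u Y_2 + w` if `m ≥ ρ^d`, `n = (u+1) Y_2 - Q + w` if
`m < ρ^d`) with `m n ∈ Z_{2+d}`, whence `ε = f (m n) = f m · ε` and `ε = ±1`. [folklore] -/
theorem eq_one_of_blocks_window (hk : 2 ≤ k) (hmul : ∀ m n, f (m * n) = f m * f n)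
    (hval : ∀ n, n ≠ 0 → f n = 1 ∨ f n = -1) {l J π u w : ℕ} {ε : ℤ}
    (hπ : 1 ≤ π) (hu : 1 ≤ u) (hw : w < k ^ l)
    (hblock : ∀ tt v : ℕ, v < k ^ (J + tt * π) →
      f (u * k ^ (l + J + tt * π) + k ^ l * v + w) = ε)
    (d m : ℕ) (hm1 : m % k ^ l = 1) (hlo : 4 * u * (k ^ π) ^ d ≤ (4 * u + 1) * m)
    (hhi : 4 * u * m ≤ (4 * u + 1) * (k ^ π) ^ d) : f m = 1 := by
  have hk0 : 0 < k := by omega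
  have hZ := const_on_blocks hk hblock
  obtain ⟨Q, hQdef⟩ : ∃ Q, Q = k ^ l := ⟨_, rfl⟩
  obtain ⟨ρ, hρdef⟩ : ∃ ρ, ρ = k ^ π := ⟨_, rfl⟩
  rw [← hQdef] at hZ hm1 hw
  rw [← hρdef] at hlo hhi
  have hρ2 : 2 ≤ ρ := le_trans hk (by rw [hρdef]; exact Nat.le_self_pow (by omega) k)
  have hP : 0 < ρ ^ d := pow_pos (by omega) d
  -- the scale `Y_2 = Q c`, `c = k^J ρ^2 ≥ 4`, and `Y_{2+d} = Q c ρ^d`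
  obtain ⟨c, hcdef⟩ : ∃ c, c = k ^ J * ρ ^ 2 := ⟨_, rfl⟩
  have hY2 : k ^ (l + J + 2 * π) = Q * c := by
    rw [hcdef, hQdef, hρdef, ← pow_mul, ← pow_add, ← pow_add]; congr 1; ring
  have hYd : k ^ (l + J + (2 + d) * π) = Q * c * ρ ^ d := by
    rw [← hY2, hρdef, ← pow_mul, ← pow_add]; congr 1; ring
  have hZ2 : ∀ n, u * (Q * c) ≤ n → n < (u + 1) * (Q * c) → n % Q = w → f n = ε := by
    rw [← hY2]; exact hZ 2
  have hZd : ∀ n, u * (Q * c * ρ ^ d) ≤ n → n < (u + 1) * (Q * c * ρ ^ d) → n % Q = w →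
      f n = ε := by
    rw [← hYd]; exact hZ (2 + d)
  have hc4 : 4 ≤ c := by
    have h1 : 1 ≤ k ^ J := Nat.one_le_pow J k hk0
    have h2 : 2 * 2 ≤ ρ ^ 2 := by rw [sq]; exact Nat.mul_le_mul hρ2 hρ2
    calc 4 = 1 * (2 * 2) := rfl
      _ ≤ k ^ J * ρ ^ 2 := Nat.mul_le_mul h1 h2
      _ = c := hcdef.symm
  have h4Q : 4 * Q ≤ Q * c := by rw [mul_comm]; exact Nat.mul_le_mul_left Q hc4
  have hwQ : w < Q := hw
  have hmulmod : ∀ n, n % Q = w → (m * n) % Q = w := by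
    intro n hn
    rw [Nat.mul_mod, hm1, hn, one_mul, Nat.mod_eq_of_lt hwQ]
  -- it suffices to find `n ≠ 0` with `f n = ε = f (m n)`
  suffices ∃ n, n ≠ 0 ∧ f n = ε ∧ f (m * n) = ε by
    obtain ⟨n, hn0, hn, hmn⟩ := this
    have hε : ε ≠ 0 := by
      rw [← hn]
      rcases hval n hn0 with h | h <;> simp [h]
    have key : f m * ε = 1 * ε := by rw [hmul, hn] at hmn; rw [hmn, one_mul]
    exact mul_right_cancel₀ hε key
  rcases Nat.lt_or_ge m (ρ ^ d) with hdm | hdm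
  · -- `m < ρ^d`: take `n := (u+1) Y - Q + w = u Y + Q c' + w` where `c = c' + 1`
    obtain ⟨c', rfl⟩ : ∃ c', c = c' + 1 := ⟨c - 1, by omega⟩
    obtain ⟨hnge, hnlt, hmnge, hmnlt⟩ :=
      window_arith_lt (Q := Q) (w := w) hu hwQ (by omega : 1 ≤ c') hlo hdm
    have hnmod : (u * (Q * (c' + 1)) + Q * c' + w) % Q = w := by
      rw [show u * (Q * (c' + 1)) + Q * c' + w = Q * (u * (c' + 1) + c') + w by ring,
        Nat.mul_add_mod, Nat.mod_eq_of_lt hwQ]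
    have hnpos : 0 < u * (Q * (c' + 1)) + Q * c' + w := by
      have := Nat.mul_pos hu (Nat.mul_pos (by omega : 0 < Q) (by omega : 0 < c' + 1))
      omega
    exact ⟨_, Nat.pos_iff_ne_zero.mp hnpos, hZ2 _ hnge hnlt hnmod,
      hZd _ hmnge hmnlt (hmulmod _ hnmod)⟩
  · -- `m ≥ ρ^d`: take `n := u Y + w`
    obtain ⟨hmnge, hmnlt⟩ := window_arith_ge hu hwQ h4Q hhi hdm hP
    have hn₀mod : (u * (Q * c) + w) % Q = w := by
      rw [show u * (Q * c) + w = Q * (u * c) + w by ring, Nat.mul_add_mod, Nat.mod_eq_of_lt hwQ]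
    have hupos : 0 < u * (Q * c) := Nat.mul_pos hu (Nat.mul_pos (by omega) (by omega))
    refine ⟨u * (Q * c) + w, by omega, hZ2 _ le_self_add ?_ hn₀mod, hZd _ hmnge hmnlt
      (hmulmod _ hn₀mod)⟩
    calc u * (Q * c) + w < u * (Q * c) + Q * c := by omega
      _ = (u + 1) * (Q * c) := by ring

/-- Binomial lower bound `x^{n+1} + n x^n ≤ x (x+1)^n` (i.e. `(x+1)^n ≥ x^n + n x^{n-1}`).
[folklore] -/
theorem pow_succ_add_mul_pow_le (x : ℕ) : ∀ n : ℕ, x ^ (n + 1) + n * x ^ n ≤ x * (x + 1) ^ n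
  | 0 => by simp
  | n + 1 => by
    have ih := pow_succ_add_mul_pow_le x n
    have e : (x ^ (n + 1) + n * x ^ n) * (x + 1) =
        x ^ (n + 1 + 1) + (n + 1) * x ^ (n + 1) + n * x ^ n := by ring
    calc x ^ (n + 1 + 1) + (n + 1) * x ^ (n + 1)
        ≤ x ^ (n + 1 + 1) + (n + 1) * x ^ (n + 1) + n * x ^ n := Nat.le_add_right _ _
      _ = (x ^ (n + 1) + n * x ^ n) * (x + 1) := e.symm
      _ ≤ (x * (x + 1) ^ n) * (x + 1) := Nat.mul_le_mul_right _ ih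
      _ = x * (x + 1) ^ (n + 1) := by ring

/-- **Schlage-Puchta 2011, Proposition 1, for `±1`-valued functions — elementary proof.** A
completely multiplicative `f : ℕ → ℤ` with `f n = ±1` for `n ≥ 1` and finite `k`-kernel
(`k ≥ 2`) is identically `1` on the residue class `1 (mod k^l)` for some `l ≥ 1`. (Printed, for
non-vanishing completely multiplicative complex-valued `q`-automatic `f`: "there exists an
integer `k`, such that if `n₁, n₂, ℓ` are integers such that `(n₁, q^{ℓ+1}) ∣ q^ℓ`, and
`n₁ ≡ n₂ (mod q^{k+ℓ})`, then `f(n₁) = f(n₂)`"; the case `ℓ = 0`, `n₂ = 1` is this statement.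
Printed proof: van der Waerden + Wirsing–Halász; here: `exists_blocks_const` + the window lemma
+ the walk `y z^i`, `z = (k^s + 1)^2`, of the module docstring.)
[cite: Schlagepuchta2011, Proposition 1] -/
theorem exists_pow_forall_mod_eq_one (hk : 2 ≤ k) (hmul : ∀ m n, f (m * n) = f m * f n)
    (hval : ∀ n, n ≠ 0 → f n = 1 ∨ f n = -1) (hK : IsKAutomatic k f) :
    ∃ l : ℕ, 1 ≤ l ∧ ∀ y : ℕ, y % k ^ l = 1 → f y = 1 := by
  obtain ⟨l, J, π, u, w, ε, hl, hπ, hu, hw, hblock⟩ := exists_blocks_const hk hmul hval hK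
  refine ⟨l, hl, fun y hy => ?_⟩
  by_contra hfy
  have hWIN := eq_one_of_blocks_window hk hmul hval hπ hu hw hblock
  have hk0 : 0 < k := by omega
  obtain ⟨Q, hQdef⟩ : ∃ Q, Q = k ^ l := ⟨_, rfl⟩
  obtain ⟨ρ, hρdef⟩ : ∃ ρ, ρ = k ^ π := ⟨_, rfl⟩
  rw [← hQdef] at hy hWIN
  rw [← hρdef] at hWIN
  have hQ1 : 1 < Q := by rw [hQdef]; exact Nat.one_lt_pow (by omega) (by omega)
  have hρ1 : 1 < ρ := by rw [hρdef]; exact Nat.one_lt_pow (by omega) (by omega)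
  have hy0 : y ≠ 0 := by rintro rfl; simp at hy
  have hfy' : f y = -1 := (hval y hy0).resolve_left hfy
  have hf1 : f 1 = 1 := by
    have h := hmul 1 1
    rcases hval 1 one_ne_zero with h1 | h1
    · exact h1
    · rw [mul_one, h1] at h; norm_num at h
  -- the square `z = (K₀ + 1)^2`, `K₀ = k^{π s'}`, `s' = l + 12 u + 1`
  obtain ⟨s', hs'def⟩ : ∃ s', s' = l + 12 * u + 1 := ⟨_, rfl⟩
  obtain ⟨K₀, hK₀def⟩ : ∃ K₀, K₀ = k ^ (π * s') := ⟨_, rfl⟩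
  have hK₀ge : 12 * u + 2 ≤ K₀ := by
    have h1 : π * s' < K₀ := by rw [hK₀def]; exact Nat.lt_pow_self (by omega)
    have h2 : s' ≤ π * s' := Nat.le_mul_of_pos_left _ (by omega)
    omega
  have hQK₀ : Q ∣ K₀ := by
    rw [hQdef, hK₀def]
    exact pow_dvd_pow k (le_trans (by omega : l ≤ s') (Nat.le_mul_of_pos_left _ (by omega)))
  have hρE : ρ ^ (2 * s') = K₀ ^ 2 := by
    rw [hρdef, hK₀def, ← pow_mul, ← pow_mul]; congr 1; ring
  obtain ⟨z, hzdef⟩ : ∃ z, z = (K₀ + 1) ^ 2 := ⟨_, rfl⟩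
  have hz1 : z % Q = 1 := by
    obtain ⟨c, hc⟩ := hQK₀
    rw [hzdef, hc, show (Q * c + 1) ^ 2 = Q * (c * (Q * c + 2)) + 1 by ring, Nat.mul_add_mod,
      Nat.mod_eq_of_lt hQ1]
  have hfz : f z = 1 := by
    rw [hzdef, sq, hmul]
    rcases hval (K₀ + 1) (by omega) with h | h <;> simp [h]
  have hfzi : ∀ i, f (z ^ i) = 1 := by
    intro i
    induction i with
    | zero => simpa using hf1
    | succ n ih => rw [pow_succ, hmul, ih, hfz, one_mul]
  have hzgt : K₀ ^ 2 + 1 ≤ z := by rw [hzdef]; nlinarith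
  have hzle : 4 * u * z ≤ (4 * u + 1) * K₀ ^ 2 := by
    rw [hzdef]; nlinarith [hK₀ge]
  -- the exponent `a` with `ρ^a ≤ y < ρ^{a+1}`
  obtain ⟨a, hadef⟩ : ∃ a, a = Nat.log ρ y := ⟨_, rfl⟩
  have ha1 : ρ ^ a ≤ y := by rw [hadef]; exact Nat.pow_log_le_self ρ hy0
  have ha2 : y < ρ ^ (a + 1) := by rw [hadef]; exact Nat.lt_pow_succ_log_self hρ1 y
  -- the walk `y z^i` eventually passes `ρ^{a + 2 s' i + 1}` (up to the factor `1 + 1/(4u)`)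
  have hex : ∃ i, 4 * u * ρ ^ (a + 2 * s' * i + 1) < (4 * u + 1) * (y * z ^ i) := by
    obtain ⟨n, hndef⟩ : ∃ n, n = ρ * K₀ ^ 2 := ⟨_, rfl⟩
    have hx : 0 < K₀ ^ 2 := pow_pos (by omega) 2
    have h2 : K₀ ^ 2 * (ρ * (K₀ ^ 2) ^ n) ≤ K₀ ^ 2 * (K₀ ^ 2 + 1) ^ n :=
      calc K₀ ^ 2 * (ρ * (K₀ ^ 2) ^ n) = n * (K₀ ^ 2) ^ n := by rw [hndef]; ring
        _ ≤ (K₀ ^ 2) ^ (n + 1) + n * (K₀ ^ 2) ^ n := Nat.le_add_left _ _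
        _ ≤ K₀ ^ 2 * (K₀ ^ 2 + 1) ^ n := pow_succ_add_mul_pow_le _ n
    have h3 : ρ * (K₀ ^ 2) ^ n ≤ z ^ n :=
      le_trans (Nat.le_of_mul_le_mul_left h2 hx) (Nat.pow_le_pow_left hzgt n)
    refine ⟨n, ?_⟩
    calc 4 * u * ρ ^ (a + 2 * s' * n + 1) < (4 * u + 1) * ρ ^ (a + 2 * s' * n + 1) :=
          Nat.mul_lt_mul_of_pos_right (by omega) (pow_pos (by omega) _)
      _ = (4 * u + 1) * (ρ ^ a * (ρ * (K₀ ^ 2) ^ n)) := by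
          rw [← hρE, ← pow_mul]; ring
      _ ≤ (4 * u + 1) * (y * z ^ n) := Nat.mul_le_mul_left _ (Nat.mul_le_mul ha1 h3)
  classical
  obtain ⟨i₀, hi₀, hmin⟩ : ∃ i₀, 4 * u * ρ ^ (a + 2 * s' * i₀ + 1) < (4 * u + 1) * (y * z ^ i₀) ∧
      ∀ j < i₀, ¬ 4 * u * ρ ^ (a + 2 * s' * j + 1) < (4 * u + 1) * (y * z ^ j) :=
    ⟨Nat.find hex, Nat.find_spec hex, fun j hj => Nat.find_min hex hj⟩
  -- `m := y z^{i₀}` is `≡ 1 (mod Q)` and lies in the window around `ρ^{a + 2 s' i₀ + 1}`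
  have hm1 : (y * z ^ i₀) % Q = 1 := by
    rw [Nat.mul_mod, hy, Nat.pow_mod, hz1, one_pow, Nat.one_mod_eq_one.mpr hQ1.ne', one_mul,
      Nat.one_mod_eq_one.mpr hQ1.ne']
  have hhi : 4 * u * (y * z ^ i₀) ≤ (4 * u + 1) * ρ ^ (a + 2 * s' * i₀ + 1) := by
    rcases Nat.eq_zero_or_pos i₀ with hi | hi
    · rw [hi]
      calc 4 * u * (y * z ^ 0) = 4 * u * y := by simp
        _ ≤ 4 * u * ρ ^ (a + 1) := Nat.mul_le_mul_left _ ha2.le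
        _ ≤ (4 * u + 1) * ρ ^ (a + 2 * s' * 0 + 1) := by
            simp only [mul_zero, add_zero]; exact Nat.mul_le_mul_right _ (by omega)
    · obtain ⟨i, rfl⟩ : ∃ i, i₀ = i + 1 := ⟨i₀ - 1, by omega⟩
      have hneg := not_lt.mp (hmin i (by omega))
      have : (4 * u + 1) * (4 * u * (y * z ^ (i + 1))) ≤
          (4 * u + 1) * (4 * u * ρ ^ (a + 2 * s' * (i + 1) + 1)) :=
        calc (4 * u + 1) * (4 * u * (y * z ^ (i + 1)))
            = 4 * u * ((4 * u + 1) * (y * z ^ i)) * z := by ring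
          _ ≤ 4 * u * (4 * u * ρ ^ (a + 2 * s' * i + 1)) * z := Nat.mul_le_mul_right _
              (Nat.mul_le_mul_left _ hneg)
          _ = 4 * u * ρ ^ (a + 2 * s' * i + 1) * (4 * u * z) := by ring
          _ ≤ 4 * u * ρ ^ (a + 2 * s' * i + 1) * ((4 * u + 1) * K₀ ^ 2) :=
              Nat.mul_le_mul_left _ hzle
          _ = (4 * u + 1) * (4 * u * ρ ^ (a + 2 * s' * (i + 1) + 1)) := by
              rw [← hρE]; ring
      have h4 : 4 * u * (y * z ^ (i + 1)) ≤ 4 * u * ρ ^ (a + 2 * s' * (i + 1) + 1) :=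
        Nat.le_of_mul_le_mul_left this (by omega)
      exact le_trans h4 (Nat.mul_le_mul_right _ (by omega))
  have h1 := hWIN _ _ hm1 hi₀.le hhi
  rw [hmul, hfy', hfzi] at h1
  norm_num at h1

end CompletelyMultiplicative

/-- **Coons 2010, Theorem 1.5: Liouville's `λ` is not `k`-automatic for any `k ≥ 2`** —
discharge of the named fact `coons_liouville_not_automatic` ("Liouville's function, `λ`, is not
`k`–automatic for any `k ≥ 2`"). Proof (elementary, not the printed analytic one): by
`exists_pow_forall_mod_eq_one` a `k`-automatic `λ` would equal `1` at all `n ≡ 1 (mod k^l)` for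
some `l ≥ 1`; but there is a prime `p ≡ 1 (mod k^l)` (`Nat.exists_prime_gt_modEq_one`) and
`λ p = (-1)^{Ω p} = -1`. [cite: Coons2011, Theorem 1.5] -/
theorem coons_liouville_not_automatic_holds : coons_liouville_not_automatic := by
  intro k hk hK
  have hval : ∀ n : ℕ, n ≠ 0 → (fun n : ℕ => (ArithmeticFunction.liouville n : ℤ)) n = 1 ∨
      (fun n : ℕ => (ArithmeticFunction.liouville n : ℤ)) n = -1 := fun n hn => by
    simpa only [ArithmeticFunction.liouville_apply hn] using neg_one_pow_eq_or ℤ _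
  obtain ⟨l, hl, hall⟩ :=
    exists_pow_forall_mod_eq_one hk (fun m n => ArithmeticFunction.liouville_apply_mul m n) hval hK
  have hQ1 : 1 < k ^ l := Nat.one_lt_pow (by omega) (by omega)
  obtain ⟨p, hp, -, hpmod⟩ := Nat.exists_prime_gt_modEq_one 0 (by positivity : k ^ l ≠ 0)
  have h1 : p % k ^ l = 1 := by
    rw [Nat.ModEq] at hpmod; rwa [Nat.one_mod_eq_one.mpr hQ1.ne'] at hpmod
  have h2 := hall p h1
  simp only [ArithmeticFunction.liouville_apply hp.ne_zero,
    ArithmeticFunction.cardFactors_apply_prime hp, pow_one] at h2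
  norm_num at h2

end Literature.Computability.Complexity
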